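import Summits.BirchSwinnertonDyer.BirchSwinnertonDyer.Theorems.CumulativeHeegnerLeopoldtCumulativeHeegnerInclusionAtThreeLayerControlCell
import Summits.BirchSwinnertonDyer.BirchSwinnertonDyer.Theorems.CumulativeHeegnerLeopoldtCumulativeHeegnerInclusionAtThreeLayerControlDual
import Summits.BirchSwinnertonDyer.BirchSwinnertonDyer.Theorems.CumulativeHeegnerLeopoldtCumulativeHeegnerInclusionAtThreeLayerTowerControl
import Summits.BirchSwinnertonDyer.Rank1Residual.X11b.AnticyclotomicModuleFinite
import HarnessLib

/-!
# Crux K1 `CumulativeHeegnerInclusionAtThree` (stmt-BirchSwinnertonDyer-24198) / crux A (stmt-26896): the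
# port [P-ctl], V — the layer-tower door (LT) with Σ-IMPRIMITIVE layer Selmer duals and EXACT control:
# `∀ m, θ_m ∈ Fitt_Λ(Hom(Sel_{𝔭′}^Σ(K_m, E[3^∞]), ℚ/ℤ))·R₀⟦T⟧ ∧ 3^μ L ≡ θ_m (mod 3^m, ω_m)  ⟹  A` — NO control input

Width seat bsd-line-chl-k1-p1-w8 (`--supports stmt-BirchSwinnertonDyer-24198`). THEOREMS ONLY (no definition, no named
fact, no `sorry`). Capstone of [P-ctl] I–IV (p648123, p648821, p649336, p650823): the (LT) door of crux A
(`…LayerTower.temperedHeegnerInclusionAtThree_of_fittingLayerTower`, p637184) asks for `3^μ L ∈ Fitt_Λ(X_{∅,0}(𝔭′))·R₀⟦T⟧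
+ (3^m) + (ω_m)` at every layer; its module-level supplier (`…LayerTowerControl`, p637962) asks for LAYER DATA
`C_m → X ⧸ ω_m X → N_m → 0` plus a layer element `θ_m ∈ Fitt(N_m)` and a layer congruence. On the Leopoldt cell the
layer data EXIST with `C_m = 0` for every FINITE `Σ ⊇ {bad v ∤ 3}` (III exact control + IV dual packaging:
`X^Σ ⧸ ω_m X^Σ ≅ₗ[Λ] N_m^Σ := Hom(Sel_{𝔭′}^Σ(K_m, E[3^∞]), ℚ/ℤ)`), and `Fitt₀(X^Σ) ⊆ Fitt₀(X^∅)` (IV). Hence: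

* §1 `mem_map_fittingIdeal_sup_of_control` (generic `E/K`, any `p`, `Σ`, layer `n`, ring map `φ : Λ → R`, error ideal
  `𝔟 ∋ φ ω_n`): exact control at layer `n` + `θ ∈ Fitt(N_n^Σ)·R` + `t·L ∈ (θ) + 𝔟` ⟹ `t·L ∈ Fitt(X^Σ)·R + 𝔟` and
  `t·L ∈ Fitt(X^∅)·R + 𝔟`.
* §2 `cell_fittingLayerTower_of_sigmaLayerTower` — on the Leopoldt cell (every `ℤ₃`-tower, generator, `𝔭′ ∋ 3`, finite
  `Σ ⊇ bad`): a Σ-imprimitive layer tower `(θ_m)_m` with uniform `μ` gives the (LT) clause for `X_{∅,0}(𝔭′)` at EVERY `m`.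
* (companion door file `…LayerTowerSigmaDoor`, which imports the route file: A BY NAME from (LT^Σ) at every frame,
  with NO control / Tamagawa input, and K1 BY NAME from P ∧ (LT^Σ).) This file is ROUTE-INDEPENDENT (no `Theses` import).

The trade made explicit: (LT) for `X_{∅}` needs the Tamagawa-type kernels `ker r_{m,v}` at the bad `v ∣ N`, `v ∤ 3` (the
`C_m`); (LT^Σ) needs none of them but asks the layer argument to bound the Σ-IMPRIMITIVE layer Selmer group by the SAME
`θ_m` (on the `L`-side this is where the Euler factors at `Σ` would enter). Neither layer argument ([R-layer-KS],
[R-layer-rec]) is in print at additive `3`: crux A (26896) and K1 (24198) stay OPEN; BSD is not proved by any of this; no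
summit statement is proved by this seat.

References: [GreenbergLNM1716] §3 p. 90, §1 p. 62; [MazurTate1987] §1; [KimKurihara2021] §1; [StacksProject] Tag 07ZA;
[JetchevSkinnerWan2017] §3.3 (Σ-imprimitive Selmer groups; shape only); [Castella2018] Def. 2.2.
-/

set_option linter.dupNamespace false
set_option autoImplicit false

noncomputable section

open scoped Classical

namespace Summit.BirchSwinnertonDyer.BirchSwinnertonDyer.Theorems.CumulativeHeegnerInclusionAtThreeLayerTowerSigma

open NumberField IsDedekindDomain Field
open Literature.NumberTheory.EllipticCurves Literature.NumberTheory.EllipticCurves.GreenbergSelmer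
open Literature.NumberTheory.EllipticCurves.IwasawaDual
open Literature.NumberTheory.GaloisRepresentations Literature.RingTheory.FittingIdeal
open Summit.BirchSwinnertonDyer.Rank1Residual.X11b Summit.BirchSwinnertonDyer.Rank1Residual.X11b.AcSelmer
open Summit.BirchSwinnertonDyer.BirchSwinnertonDyer.Theorems.BiquadraticEisensteinDescentDefs
open Summit.BirchSwinnertonDyer.BirchSwinnertonDyer.Theorems.CumulativeHeegnerInclusionAtThreeLayerControlCell
open Summit.BirchSwinnertonDyer.BirchSwinnertonDyer.Theorems.CumulativeHeegnerInclusionAtThreeLayerControlDual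
open Summit.BirchSwinnertonDyer.BirchSwinnertonDyer.Theorems.CumulativeHeegnerInclusionAtThreeLayerTowerControl

/-! ## §1 One layer, exact control: `θ ∈ Fitt(N_n^Σ)·R`, `t·L ∈ (θ) + 𝔟` ⟹ `t·L ∈ Fitt(X^Σ)·R + 𝔟 ⊆ Fitt(X^∅)·R + 𝔟` -/

section Generic

variable {K : Type} [Field K] [NumberField K] {p : ℕ} [Fact p.Prime] (κ : ZpExtension K p)
  (W : WeierstrassCurve K) (𝔭 : HeightOneSpectrum (𝓞 K)) (S : Set (HeightOneSpectrum (𝓞 K)))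
  (γ : absoluteGaloisGroup K) [hγ : Fact (κ.IsTopGenerator γ)] (n : ℕ)

/-- **One layer of the Σ-imprimitive tower, module level.** Exact control at layer `n` (`s_n` injective and onto the
`conj_{γ^{pⁿ}}`-invariants), a layer element `θ ∈ Fitt_Λ(Hom(Sel_𝔭^Σ(K_n, E[p^∞]), ℚ/ℤ))·R` (any presentation
`(f, h)` of the layer dual) and a layer congruence `t·L ∈ (θ) + 𝔟` with `φ(ω_n) ∈ 𝔟` give
`t·L ∈ Fitt_Λ(X_ac^Σ)·R + 𝔟` AND `t·L ∈ Fitt_Λ(X_ac^∅)·R + 𝔟` (IV: `Fitt(N_n^Σ) ⊆ Fitt(X^Σ) + (ω_n)`,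
`Fitt(X^Σ) ⊆ Fitt(X^∅)`). The layer-`n` instance of hypothesis (LT) with `C_n = 0`. [cite: MazurTate1987, §1] [cite: StacksProject, Tag 07ZA (3)] -/
theorem mem_map_fittingIdeal_sup_of_control [Module.Finite (IwasawaAlgebra p) (XAc W p κ 𝔭 S γ)]
    (f : AddMonoid.End ↥(selmerOver (κ.layerSubgroup n) (W.geomPrimaryTorsion p) p 𝔭 S))
    (hf : ∀ s, ((f s : selmerOver (κ.layerSubgroup n) (W.geomPrimaryTorsion p) p 𝔭 S) :
      W.subgroupH1 p (κ.layerSubgroup n)) = W.conjH1 p (κ.layerSubgroup n) γ s)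
    (h : IsLocNil p (f - 1))
    (hinj : Function.Injective (W.resOfLe p (κ.kerSubgroup_le_layerSubgroup n)))
    (hsurj : ∀ a ∈ selmerAc W p κ 𝔭 S, W.conjH1 p κ.kerSubgroup (γ ^ p ^ n) a = a →
      ∃ c ∈ selmerOver (κ.layerSubgroup n) (W.geomPrimaryTorsion p) p 𝔭 S,
        W.resOfLe p (κ.kerSubgroup_le_layerSubgroup n) c = a)
    {R : Type*} [CommRing R] (φ : IwasawaAlgebra p →+* R) (𝔟 : Ideal R)
    (hω : φ ((1 + PowerSeries.X : IwasawaAlgebra p) ^ (p ^ n) - 1) ∈ 𝔟) {θ t L : R}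
    (hθ : θ ∈ (Module.fittingIdeal (IwasawaAlgebra p)
      (LocNilDual (selmerOver (κ.layerSubgroup n) (W.geomPrimaryTorsion p) p 𝔭 S) f h) 0).map φ)
    (hrec : t * L ∈ Ideal.span {θ} ⊔ 𝔟) :
    t * L ∈ (Module.fittingIdeal (IwasawaAlgebra p) (XAc W p κ 𝔭 S γ) 0).map φ ⊔ 𝔟 ∧
      t * L ∈ (Module.fittingIdeal (IwasawaAlgebra p) (XAc W p κ 𝔭 ∅ γ) 0).map φ ⊔ 𝔟 := by
  -- `θ ∈ Fitt(X^Σ)·R + (φ ω_n) ⊆ Fitt(X^Σ)·R + 𝔟`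
  have hθ' : θ ∈ (Module.fittingIdeal (IwasawaAlgebra p) (XAc W p κ 𝔭 S γ) 0).map φ ⊔ 𝔟 := by
    have hle := Ideal.map_mono (f := φ)
      (fittingIdeal_layer_le_sup_of_control κ W 𝔭 S γ n f hf h hinj hsurj)
    rw [Ideal.map_sup, Ideal.map_span, Set.image_singleton] at hle
    exact (sup_le_sup_left ((Ideal.span_singleton_le_iff_mem _).mpr hω) _) (hle hθ)
  -- `t · L = r θ + b`
  have h1 : t * L ∈ (Module.fittingIdeal (IwasawaAlgebra p) (XAc W p κ 𝔭 S γ) 0).map φ ⊔ 𝔟 := by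
    obtain ⟨y, hy, b, hb, hyb⟩ := Submodule.mem_sup.mp hrec
    obtain ⟨r, rfl⟩ := Ideal.mem_span_singleton'.mp hy
    rw [← hyb]
    exact Ideal.add_mem _ (Ideal.mul_mem_left _ r hθ') (Ideal.mem_sup_right hb)
  exact ⟨h1, (sup_le_sup_right (Ideal.map_mono (fittingIdeal_XAc_le_empty κ W 𝔭 S γ)) 𝔟) h1⟩

end Generic

/-! ## §2 The Leopoldt cell: a Σ-imprimitive layer tower gives (LT) for `X_{∅,0}(𝔭′)` at every layer -/

/-- **On the Leopoldt cell, (LT^Σ) ⟹ (LT).** `E/ℚ` of class O6 at `3` with a non-anomalous rational line, `N = N_E`, `K`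
imaginary quadratic Heegner for `N`; EVERY `ℤ₃`-extension `κ` with topological generator `γ`, every `𝔭′ ∋ 3`, every FINITE
`Σ ⊇ {v ∤ 3 of bad reduction}`, every `μ`, `L`. If at every layer `m` there are a presentation `(f, h)` of the layer dual
`N_m^Σ = Hom(Sel_{𝔭′}^Σ(K_m, E[3^∞]), ℚ/ℤ)` and a layer element `θ_m ∈ Fitt_Λ(N_m^Σ)·R₀⟦T⟧` with
`3^μ L ∈ (θ_m) + (3^m) + (ω_m)`, then `3^μ L ∈ Fitt_Λ(X_{∅,0}(𝔭′))·R₀⟦T⟧ + (3^m) + (ω_m)` for every `m` — the (LT)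
clause of `…LayerTower.temperedHeegnerInclusionAtThree_of_fittingLayerTower`. Control is EXACT (III
`cell_layerControl_of_bad_subset`), `X^Σ` is finitely generated (`XAc.module_finite`), §1 at each layer.
[cite: GreenbergLNM1716, §3 p. 90] [cite: MazurTate1987, §1] [cite: KimKurihara2021, §1] -/
theorem cell_fittingLayerTower_of_sigmaLayerTower :
    ∀ (W : WeierstrassCurve ℚ) [W.IsElliptic] [W.IsGloballyMinimal] (N : ℕ) [NeZero N] (K : Type) [Field K]
      [NumberField K], Summit.BirchSwinnertonDyer.Rank1Residual.Additive.ClassO6 W 3 →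
      (∃ Φ : AddSubgroup (WeierstrassCurve.geomTorsion W ((3 : ℕ) : ℤ)),
        Literature.NumberTheory.EllipticCurves.Rank1Residual.IsRationalLine W 3 Φ ∧
        ∀ (v : IsDedekindDomain.HeightOneSpectrum (NumberField.RingOfIntegers ℚ)),
          ((3 : ℕ) : NumberField.RingOfIntegers ℚ) ∈ v.asIdeal → ∀ 𝔓 ∈ v.primesAbove,
          ¬ (∀ g ∈ 𝔓.decompositionSubgroup (Field.absoluteGaloisGroup ℚ), ∀ P ∈ Φ, g • P = P) ∧
          ¬ (∀ g ∈ 𝔓.decompositionSubgroup (Field.absoluteGaloisGroup ℚ),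
              ∀ P : WeierstrassCurve.geomTorsion W ((3 : ℕ) : ℤ), g • P - P ∈ Φ)) →
      W.conductorNorm ℤ = N → Literature.NumberTheory.EllipticCurves.IsImaginaryQuadratic K →
      Literature.NumberTheory.EllipticCurves.SatisfiesHeegnerHypothesis N K →
      ∀ (κ : Literature.NumberTheory.EllipticCurves.ZpExtension K 3) (γ : Field.absoluteGaloisGroup K)
        [Fact (κ.IsTopGenerator γ)]
        (𝔭' : IsDedekindDomain.HeightOneSpectrum (NumberField.RingOfIntegers K)),
        ((3 : ℕ) : NumberField.RingOfIntegers K) ∈ 𝔭'.asIdeal →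
      ∀ (S : Set (IsDedekindDomain.HeightOneSpectrum (NumberField.RingOfIntegers K))), S.Finite →
      haveI : (W.baseChange K).IsElliptic := inferInstanceAs (W.map (algebraMap ℚ K)).IsElliptic
      (∀ v : HeightOneSpectrum (𝓞 K), ((3 : ℕ) : 𝓞 K) ∉ v.asIdeal →
        ¬ (W.baseChange K).HasGoodReductionAt v → v ∈ S) →
      ∀ (μ : ℕ) (L : UnrSeries 3),
      (∀ m : ℕ,
        ∃ (f : AddMonoid.End ↥(selmerOver (κ.layerSubgroup m) ((W.baseChange K).geomPrimaryTorsion 3) 3 𝔭' S))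
          (_ : ∀ s, ((f s : selmerOver (κ.layerSubgroup m) ((W.baseChange K).geomPrimaryTorsion 3) 3 𝔭' S) :
            (W.baseChange K).subgroupH1 3 (κ.layerSubgroup m)) = (W.baseChange K).conjH1 3 (κ.layerSubgroup m) γ s)
          (h : IsLocNil 3 (f - 1)) (θ : UnrSeries 3),
          θ ∈ (Module.fittingIdeal (IwasawaAlgebra 3)
            (LocNilDual (selmerOver (κ.layerSubgroup m) ((W.baseChange K).geomPrimaryTorsion 3) 3 𝔭' S) f h) 0).map
              (PowerSeries.map (Halves.toUnr 3)) ∧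
          (3 : UnrSeries 3) ^ μ * L ∈ Ideal.span {θ} ⊔ Ideal.span {(3 : UnrSeries 3) ^ m} ⊔
            Ideal.span {((1 + PowerSeries.X) ^ (3 ^ m) - 1 : UnrSeries 3)}) →
      ∀ m : ℕ, (3 : UnrSeries 3) ^ μ * L ∈
        (Module.fittingIdeal (IwasawaAlgebra 3) (XAc (W.baseChange K) 3 κ 𝔭' ∅ γ) 0).map
            (PowerSeries.map (Halves.toUnr 3)) ⊔
          Ideal.span {(3 : UnrSeries 3) ^ m} ⊔ Ideal.span {((1 + PowerSeries.X) ^ (3 ^ m) - 1 : UnrSeries 3)} := by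
  intro W _ _ N _ K _ _ hO6 hline hN hK hHg κ γ hγ 𝔭' h𝔭' S hSfin hbad μ L hT m
  haveI : Fact (Nat.Prime 3) := ⟨Nat.prime_three⟩
  haveI hEK : (W.baseChange K).IsElliptic := inferInstanceAs (W.map (algebraMap ℚ K)).IsElliptic
  haveI : Module.Finite (IwasawaAlgebra 3) (XAc (W.baseChange K) 3 κ 𝔭' S γ) :=
    XAc.module_finite κ 𝔭' S γ hSfin
  obtain ⟨f, hf, h, θ, hθ, hrec⟩ := hT m
  obtain ⟨hinj, hsurj⟩ :=
    cell_layerControl_of_bad_subset W N K hO6 hline hN hK hHg κ γ hγ.out 𝔭' h𝔭' S m hbad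
  have hsurj' : ∀ a ∈ selmerAc (W.baseChange K) 3 κ 𝔭' S,
      (W.baseChange K).conjH1 3 κ.kerSubgroup (γ ^ 3 ^ m) a = a →
        ∃ c ∈ selmerOver (κ.layerSubgroup m) ((W.baseChange K).geomPrimaryTorsion 3) 3 𝔭' S,
          (W.baseChange K).resOfLe 3 (κ.kerSubgroup_le_layerSubgroup m) c = a := fun a ha hfix ↦ by
    obtain ⟨c, ⟨hc, hca⟩, -⟩ := hsurj a ha hfix
    exact ⟨c, hc, hca⟩
  have hω : PowerSeries.map (Halves.toUnr 3) ((1 + PowerSeries.X : IwasawaAlgebra 3) ^ (3 ^ m) - 1) ∈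
      Ideal.span {(3 : UnrSeries 3) ^ m} ⊔ Ideal.span {((1 + PowerSeries.X) ^ (3 ^ m) - 1 : UnrSeries 3)} := by
    rw [map_toUnr_omega]
    exact Ideal.mem_sup_right (Ideal.mem_span_singleton_self _)
  have key := (mem_map_fittingIdeal_sup_of_control κ (W.baseChange K) 𝔭' S γ m f hf h hinj hsurj'
    (PowerSeries.map (Halves.toUnr 3)) _ hω hθ (by simpa only [sup_assoc] using hrec)).2
  simpa only [sup_assoc] using key

end Summit.BirchSwinnertonDyer.BirchSwinnertonDyer.Theorems.CumulativeHeegnerInclusionAtThreeLayerTowerSigma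

end
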